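import Summits.Ventures.PercRepro.GenQLargeCorank

/-!
# PercRepro — the `(8, 6)` cell: the large coranks, THE BOUND `lbSum t |G| ≤ Jq M G 6 t` (night-4, gen 5)

The weight of a rank-`6` subset `S` of `G` at type `t` is `(8 − t)/(1 + m(S)) − 8/7 ≥ Lw t |S|` with `Lw` the weight
at the largest coloop count `μ(|S|)` allowed by the size (`mTr_le_of_card_core`); summing fiberwise by size and
inserting the counts of `GenQLargeCorank` gives the explicit binomial bound `lbSum t |G|`.

* `muL`, `Lw`, `kap`, `gLB`, `lbSum`: the weight by size, `κ_j = C(21, j)/C(21, 11)`, the fiber bound, the sum;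
* `Jq_ge_sum_weight`: `J_t ≥ Σ_{S ∈ R₆(G)} ((8 − t)·w_∞(S) − 8/7)`; `weight_ge_Lw`; `sum_Lw_eq_fibers`;
* `gLB_le_fiber`: the fiber bound; **`lbSum_le_Jq`**: `lbSum t |G| ≤ Jq M G 6 t` (`t ≤ 5`).

Imports `GenQLargeCorank`.
-/
namespace PercRepro.Night4

open Finset ThmH SixFour GenQ PerFlat Star

variable {α : Type} [DecidableEq α] {M : Matroid α} [M.Finite]

/-! ## The weights by size -/

/-- `μ(j)`: the largest coloop count of a rank-`6` subset with `j` points of the core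
(`mTr_le_of_card_core`). -/
def muL (j : ℕ) : ℕ := if 13 ≤ j then 1 else if 10 ≤ j then 2 else if 8 ≤ j then 3 else if 7 ≤ j then 4 else 6

/-- The lower weight at type `t` of a rank-`6` set with `j` points: `(8 − t)/(1 + μ(j)) − 8/7`. -/
def Lw (t j : ℕ) : ℚ := ((8 : ℚ) - t) / (1 + (muL j : ℚ)) - 8 / 7

/-- `κ_j = C(21, j)/C(21, 11)`. -/
def kap (j : ℕ) : ℚ := (Nat.choose 21 j : ℚ) / (Nat.choose 21 11 : ℚ)

/-- The fiber lower bound at size `j`: `C(n, j)·Lw` for `j ≥ 22`, `(C(n, j) − κ_j·C(n, 11))·Lw` for `13 ≤ j ≤ 21`,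
`C(n, j)·min(Lw, 0)` for `6 ≤ j ≤ 12`, `0` below. -/
def gLB (t n j : ℕ) : ℚ :=
  if 22 ≤ j then (n.choose j : ℚ) * Lw t j
  else if 13 ≤ j then ((n.choose j : ℚ) - kap j * (n.choose 11 : ℚ)) * Lw t j
  else if 6 ≤ j then (n.choose j : ℚ) * min (Lw t j) 0 else 0

/-- The explicit lower bound `lbSum t n = Σ_{j ≤ n} gLB t n j`. -/
def lbSum (t n : ℕ) : ℚ := ∑ j ∈ Finset.range (n + 1), gLB t n j

/-- `J_t ≥ Σ_{S ∈ R₆(G)} ((8 − t)·w_∞(S) − 8/7)`: the demand-free count is `≥ 0`. -/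
theorem Jq_ge_sum_weight (G : Finset α) (t : ℕ) :
    ∑ S ∈ Rq M G 6, (((8 : ℚ) - t) * wInf M S - 8 / 7) ≤ Jq M G 6 t := by
  unfold Jq
  have h1 : ∑ S ∈ Rq M G 6, (((8 : ℚ) - t) * wInf M S - 8 / 7) =
      (∑ S ∈ Rq M G 6, (((6 : ℕ) : ℚ) + 2 - t) * wInf M S) - (8 / 7 : ℚ) * (Nq M G 6 : ℚ) := by
    rw [Finset.sum_sub_distrib, Finset.sum_const, nsmul_eq_mul]
    unfold Nq
    push_cast
    ring
  rw [h1]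
  have hDF : (0 : ℚ) ≤ (DFq M G 6 t : ℚ) := by positivity
  push_cast
  norm_num
  linarith

/-- The weight of `S ∈ R₆(G)` is `≥ Lw t |S|` (`t ≤ 8`). -/
theorem weight_ge_Lw (hh : CoreHyps M) {G : Finset α} {d : ℕ} (hG : G ⊆ gr M) (hcard : G.card = 6 + d)
    {t : ℕ} (ht : t ≤ 8) {S : Finset α} (hS : S ∈ Rq M G 6) :
    Lw t S.card ≤ ((8 : ℚ) - t) * wInf M S - 8 / 7 := by
  have hm := mTr_le_of_card_core hh hG hcard hS
  have hmu : mTr M S ≤ muL S.card := by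
    unfold muL
    split_ifs with h13 h10 h8 h7
    · exact hm.2.2.2.2 h13
    · exact hm.2.2.2.1 h10
    · exact hm.2.2.1 h8
    · exact hm.2.1 h7
    · exact hm.1
  unfold Lw wInf
  have h8t : (0 : ℚ) ≤ 8 - t := by
    have : (t : ℚ) ≤ 8 := by exact_mod_cast ht
    linarith
  have hmu' : (mTr M S : ℚ) ≤ muL S.card := by exact_mod_cast hmu
  have hpos : (0 : ℚ) < 1 + (mTr M S : ℚ) := by positivity
  rw [mul_one_div]
  gcongr

omit [DecidableEq α] in
/-- The sum of the lower weights, fiberwise by size. -/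
theorem sum_Lw_eq_fibers (G : Finset α) (t : ℕ) :
    ∑ S ∈ Rq M G 6, Lw t S.card =
      ∑ j ∈ Finset.range (G.card + 1), (((Rq M G 6).filter (fun S : Finset α => S.card = j)).card : ℚ) * Lw t j := by
  rw [← Finset.sum_fiberwise_of_maps_to (s := Rq M G 6) (t := Finset.range (G.card + 1))
    (g := fun S : Finset α => S.card) (fun S hS => Finset.mem_coe.2 (Finset.mem_range.2
      (Nat.lt_succ_of_le (Finset.card_le_card (mem_Rq.1 hS).1))))]
  apply Finset.sum_congr rfl
  intro j _
  rw [Finset.card_eq_sum_ones, Nat.cast_sum, Finset.sum_mul]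
  apply Finset.sum_congr rfl
  intro S hS
  rw [(Finset.mem_filter.1 hS).2]
  push_cast
  ring

/-- The fiber lower bound: `gLB t |G| j ≤ #{S ∈ R₆ : |S| = j}·Lw t j` (`3 ≤ t ≤ 5`). -/
theorem gLB_le_fiber (hh : CoreHyps M) {G : Finset α} (hG : G ⊆ gr M)
    (hrG : M.eRk (G : Set α) = ((6 : ℕ) : ℕ∞)) {t : ℕ} (ht : t ≤ 5) (j : ℕ) :
    gLB t G.card j ≤ (((Rq M G 6).filter (fun S : Finset α => S.card = j)).card : ℚ) * Lw t j := by
  unfold gLB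
  split_ifs with h22 h13 h6
  · rw [card_filter_Rq_eq_choose hh hG hrG h22]
  · -- `13 ≤ j ≤ 21`: `Lw ≥ 0` and the fiber is `≥ C(n, j) − κ_j C(n, 11)`
    have hL : (0 : ℚ) ≤ Lw t j := by
      unfold Lw muL
      rw [if_pos h13]
      have : (t : ℚ) ≤ 5 := by exact_mod_cast ht
      push_cast
      have h2 : ((8 : ℚ) - t) / (1 + 1) = (8 - t) / 2 := by norm_num
      rw [h2]
      linarith
    apply mul_le_mul_of_nonneg_right _ hL
    have hA := choose_le_card_filter_Rq_add hh hG hrG h13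
    have hB := sum_flats_choose_le hh hG h13 (by omega)
    have hpos : (0 : ℚ) < (Nat.choose 21 11 : ℚ) := by
      have : 0 < Nat.choose 21 11 := Nat.choose_pos (by norm_num)
      exact_mod_cast this
    have hA' : (G.card.choose j : ℚ) ≤ (((Rq M G 6).filter (fun S : Finset α => S.card = j)).card : ℚ) +
        (∑ F ∈ flatsQ M 5, (F ∩ G).card.choose j : ℕ) := by exact_mod_cast hA
    have hB' : (Nat.choose 21 11 : ℚ) * (∑ F ∈ flatsQ M 5, (F ∩ G).card.choose j : ℕ) ≤
        (Nat.choose 21 j : ℚ) * (G.card.choose 11 : ℚ) := by exact_mod_cast hB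
    have hB'' : ((∑ F ∈ flatsQ M 5, (F ∩ G).card.choose j : ℕ) : ℚ) ≤ kap j * (G.card.choose 11 : ℚ) := by
      unfold kap
      rw [div_mul_eq_mul_div, le_div_iff₀ hpos]
      linarith
    linarith
  · -- `6 ≤ j ≤ 12`: the fiber is `≤ C(n, j)`, the weight `≥ min(Lw, 0)`
    have hc : (((Rq M G 6).filter (fun S : Finset α => S.card = j)).card : ℚ) ≤ (G.card.choose j : ℚ) := by
      exact_mod_cast card_filter_Rq_le_choose (M := M) G j
    have hmin : min (Lw t j) 0 ≤ 0 := min_le_right _ _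
    have hmin' : min (Lw t j) 0 ≤ Lw t j := min_le_left _ _
    have hf0 : (0 : ℚ) ≤ (((Rq M G 6).filter (fun S : Finset α => S.card = j)).card : ℚ) := by positivity
    calc (G.card.choose j : ℚ) * min (Lw t j) 0
        ≤ (((Rq M G 6).filter (fun S : Finset α => S.card = j)).card : ℚ) * min (Lw t j) 0 :=
          mul_le_mul_of_nonpos_right hc hmin
      _ ≤ (((Rq M G 6).filter (fun S : Finset α => S.card = j)).card : ℚ) * Lw t j :=
          mul_le_mul_of_nonneg_left hmin' hf0
  · rw [card_filter_Rq_eq_zero_of_lt (M := M) G (by omega)]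
    simp

/-- **`lbSum t |G| ≤ Jq M G 6 t`** on a rank-`6` set of the core (`t ≤ 5`). -/
theorem lbSum_le_Jq (hh : CoreHyps M) {G : Finset α} (hG : G ⊆ gr M)
    (hrG : M.eRk (G : Set α) = ((6 : ℕ) : ℕ∞)) {t : ℕ} (ht : t ≤ 5) : lbSum t G.card ≤ Jq M G 6 t := by
  have h6 : 6 ≤ G.card := le_card_of_eRk_eq hrG
  obtain ⟨d, hd⟩ : ∃ d, G.card = 6 + d := ⟨G.card - 6, by omega⟩
  calc lbSum t G.card = ∑ j ∈ Finset.range (G.card + 1), gLB t G.card j := rfl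
    _ ≤ ∑ j ∈ Finset.range (G.card + 1),
        (((Rq M G 6).filter (fun S : Finset α => S.card = j)).card : ℚ) * Lw t j :=
        Finset.sum_le_sum (fun j _ => gLB_le_fiber hh hG hrG ht j)
    _ = ∑ S ∈ Rq M G 6, Lw t S.card := (sum_Lw_eq_fibers G t).symm
    _ ≤ ∑ S ∈ Rq M G 6, (((8 : ℚ) - t) * wInf M S - 8 / 7) :=
        Finset.sum_le_sum (fun S hS => weight_ge_Lw hh hG hd (by omega) hS)
    _ ≤ Jq M G 6 t := Jq_ge_sum_weight G t

end PercRepro.Night4
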